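import Mathlib.RepresentationTheory.Irreducible
import Literature.NumberTheory.Automorphic.UnitaryGroupCohomologicalForms
import HarnessLib

/-!
# Cohomological cotangent forms are smooth vectors; an irreducible representation occurring in them is smooth
(Borel–Jacquet, Corvallis (1979), §4.2: automorphic forms are right `K_f`-finite, i.e. fixed by an open compact
subgroup; Bernstein–Zelevinsky (1976), §2.1: smooth vectors, stabilisers)

Topic `NumberTheory/Automorphic`; PROOF FILE (theorems only, no definition, no named fact, no instance, no
`sorry`) over ★ `UnitaryGroupCohomologicalForms` (`rightRep`, `smoothFun`, `conjFun`, `holCotForms`, `cohForms`) and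
★ `SmoothRepresentation` (`Representation.IsSmoothVector`, `IsSmooth`, `stabilizerSubgroup`, `smoothPart`).

* Generic transfer (namespace `Representation`, deliberate dot-notation extensions as in `SmoothRepresentation`):
  `Representation.isSmoothVector_of_injective` — along an injective equivariant linear map `θ : σ → ρ` the stabilisers
  agree, so `w` is smooth for `σ` as soon as `θ w` is smooth for `ρ` (vector-level form of the tree's
  `Representation.IsSmooth.of_injective` of `SupercuspidalSubrep`, whose hypothesis "`ρ` smooth" fails for right
  translation on ALL functions); `…isSmooth_of_injective_of_forall_isSmoothVector`;
  `…isSmooth_of_isIrreducible_of_forall_isSmoothVector` — an IRREDUCIBLE `σ` with a NON-ZERO equivariant linear map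
  into smooth vectors of `ρ` is smooth (Schur: the map is injective, Mathlib
  `Representation.IsIrreducible.injective_or_eq_zero`).
* `U(J)` cotangent forms (namespace `Literature.NumberTheory.Automorphic.UnitaryGroup.CotangentForms`, as ★ (A)):
  `isSmoothVector_rightRep_iff_mem_smoothFun`, `smoothFun_eq_smoothPart` — `smoothFun` (functions fixed by SOME open
  subgroup of `U(J)(𝔸_{F,f})`) IS the smooth part of `rightRep`; `conjFun_mem_smoothFun`; `holCotForms_le_smoothFun`,
  `cohForms_le_smoothFun`; and the E2-pin-bridge input **`isSmooth_of_equivariant_of_le_smoothFun`**: an irreducible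
  `σ` of `U(J)(𝔸_{F,f})` admitting a non-zero `rightRep`-equivariant linear map with values in any `A ≤ smoothFun`
  (e.g. `A = cohForms ιinf Kc`, or the cotangent part of a discrete automorphic `Π`) is a SMOOTH representation — the
  `σ.IsSmooth` premise of ★ `Rogawski1990.cohFinComponent_isTheta` / `cohFinComponentUnique_hol`.

References: [BorelJacquet1979] §4.2; [BernsteinZelevinsky1976] §2.1 (Def. 2.1); Mathlib `Representation.IsIrreducible`.
-/

noncomputable section

/-! ## §1 Generic: smoothness transfers along injective equivariant maps -/

namespace Representation

variable {k G V W : Type*} [Field k] [Group G] [TopologicalSpace G]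
  [AddCommGroup V] [Module k V] [AddCommGroup W] [Module k W]
  (σ : Representation k G W) (ρ : Representation k G V)

/-- **Smooth vectors pull back along injective equivariant maps.** If `θ : W → V` is `k`-linear, injective and
equivariant (`θ (σ g w) = ρ g (θ w)`), then `Stab_σ(w) = Stab_ρ(θ w)`; hence `w` is a smooth vector of `σ` whenever
`θ w` is a smooth vector of `ρ` (Bernstein–Zelevinsky (1976), §2.1: smooth = open stabiliser). Deliberate dot-notation
extension of Mathlib's `Representation`. [cite: BernsteinZelevinsky1976, §2.1] -/
theorem isSmoothVector_of_injective (θ : W →ₗ[k] V) (hθ : ∀ (g : G) (w : W), θ (σ g w) = ρ g (θ w))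
    (hinj : Function.Injective θ) {w : W} (hw : ρ.IsSmoothVector (θ w)) : σ.IsSmoothVector w := by
  have h : σ.stabilizerSubgroup w = ρ.stabilizerSubgroup (θ w) := by
    ext g
    rw [mem_stabilizerSubgroup, mem_stabilizerSubgroup, ← hθ]
    exact ⟨fun h => by rw [h], fun h => hinj h⟩
  rw [isSmoothVector_iff, h]
  exact hw

/-- A representation admitting an injective equivariant linear map all of whose values are smooth vectors is
smooth (Bernstein–Zelevinsky (1976), §2.1). [cite: BernsteinZelevinsky1976, §2.1] -/
theorem isSmooth_of_injective_of_forall_isSmoothVector (θ : W →ₗ[k] V)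
    (hθ : ∀ (g : G) (w : W), θ (σ g w) = ρ g (θ w)) (hinj : Function.Injective θ)
    (hsm : ∀ w, ρ.IsSmoothVector (θ w)) : σ.IsSmooth :=
  fun _ => σ.isSmoothVector_of_injective ρ θ hθ hinj (hsm _)

/-- **An irreducible representation occurring in the smooth vectors is smooth**: if `σ` is irreducible and
`θ : W → V` is a NON-ZERO equivariant linear map whose values are smooth vectors of `ρ`, then `σ` is smooth — by
Schur (`Representation.IsIrreducible.injective_or_eq_zero`) `θ` is injective (Bernstein–Zelevinsky (1976), §2.1;
Borel–Jacquet (1979), §4.2). [cite: BernsteinZelevinsky1976, §2.1] -/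
theorem isSmooth_of_isIrreducible_of_forall_isSmoothVector (hirr : σ.IsIrreducible) (θ : W →ₗ[k] V)
    (hθ : ∀ (g : G) (w : W), θ (σ g w) = ρ g (θ w)) (hθ0 : θ ≠ 0)
    (hsm : ∀ w, ρ.IsSmoothVector (θ w)) : σ.IsSmooth := by
  haveI := hirr
  rcases Representation.IsIrreducible.injective_or_eq_zero
      (θ.intertwiningMap_of_isIntertwiningMap σ ρ hθ) with hinj | h0
  · exact σ.isSmooth_of_injective_of_forall_isSmoothVector ρ θ hθ hinj hsm
  · refine absurd (LinearMap.ext fun w => ?_) hθ0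
    have := congrArg (fun T : σ.IntertwiningMap ρ => T w) h0
    simpa using this

end Representation

/-! ## §2 `U(J)`: `smoothFun` is the smooth part of right translation; cotangent forms are smooth vectors -/

namespace Literature.NumberTheory.Automorphic.UnitaryGroup.CotangentForms

open NumberField MulAction
open Literature.AlgebraicGeometry.ShimuraVarieties
open Literature.Geometry.ComplexHyperbolic.BallModel (U21 x₀)

section Smooth

variable {F E : Type} [Field F] [NumberField F] [Field E] [NumberField E] [Algebra F E]
  {c : E ≃ₐ[F] E} {N : ℕ} {J : Matrix (Fin N) (Fin N) E}

/-- A function fixed by an open subgroup of `U(J)(𝔸_{F,f})` is a smooth vector of right translation, and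
conversely (its stabiliser is then such a subgroup): `Φ ∈ smoothFun ↔ Stab(Φ)` open (Borel–Jacquet (1979), §4.2;
Bernstein–Zelevinsky (1976), §2.1). [cite: BorelJacquet1979, §4.2] -/
theorem isSmoothVector_rightRep_iff_mem_smoothFun {Φ : (adelicGroupData F E c N J).Adelic → (Fin 2 → ℂ)} :
    (rightRep F E c N J).IsSmoothVector Φ ↔ Φ ∈ smoothFun F E c N J := by
  constructor
  · intro h
    refine Submodule.mem_iSup_of_mem ((rightRep F E c N J).stabilizerSubgroup Φ)
      (Submodule.mem_iSup_of_mem h ?_)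
    rw [Representation.mem_invariants]
    rintro ⟨g, hg⟩
    exact hg
  · intro h
    have hle : smoothFun F E c N J ≤ (rightRep F E c N J).smoothPart.toSubmodule := by
      refine iSup₂_le fun Kf hKf Ψ hΨ => ?_
      rw [Representation.mem_invariants] at hΨ
      exact (rightRep F E c N J).isSmoothVector_of_le hKf fun g hg =>
        ((rightRep F E c N J).mem_stabilizerSubgroup Ψ g).mpr (hΨ ⟨g, hg⟩)
    exact hle h

/-- `smoothFun` IS the smooth part `V^∞` of right translation (`Representation.smoothPart`).
[cite: BorelJacquet1979, §4.2] -/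
theorem smoothFun_eq_smoothPart :
    smoothFun F E c N J = (rightRep F E c N J).smoothPart.toSubmodule := by
  ext Φ
  exact isSmoothVector_rightRep_iff_mem_smoothFun.symm

/-- Complex conjugation commutes with right translation, so it preserves `smoothFun`.
[cite: BorelJacquet1979, §4.2] -/
theorem conjFun_mem_smoothFun {Φ : (adelicGroupData F E c N J).Adelic → (Fin 2 → ℂ)}
    (h : Φ ∈ smoothFun F E c N J) : conjFun F E c N J Φ ∈ smoothFun F E c N J := by
  rw [← isSmoothVector_rightRep_iff_mem_smoothFun] at h ⊢
  refine (rightRep F E c N J).isSmoothVector_of_le h fun g hg => ?_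
  rw [Representation.mem_stabilizerSubgroup] at hg ⊢
  funext x
  have := congrFun hg x
  simp only [rightRep_apply] at this
  simp only [rightRep_apply, conjFun_apply, this]

variable {ιinf : U21 →* (adelicGroupData F E c N J).Adelic} {Kc : Subgroup (adelicGroupData F E c N J).Adelic}

/-- Holomorphic cotangent forms are smooth vectors (third conjunct of `holCotForms`). [cite: BorelJacquet1979, §4.2] -/
theorem holCotForms_le_smoothFun : holCotForms F E c N J ιinf Kc ≤ smoothFun F E c N J :=
  fun _ hΦ => (mem_holCotForms_iff.mp hΦ).2.2.1

/-- Cohomological (`(1,0) ⊕ (0,1)`) cotangent forms are smooth vectors. [cite: BorelJacquet1979, §4.2] -/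
theorem cohForms_le_smoothFun : cohForms F E c N J ιinf Kc ≤ smoothFun F E c N J := by
  refine sup_le holCotForms_le_smoothFun ?_
  rintro _ ⟨Φ, hΦ, rfl⟩
  exact conjFun_mem_smoothFun (holCotForms_le_smoothFun hΦ)

/-- A member of `smoothFun` (e.g. of `cohForms`) is a smooth vector of `rightRep`. [cite: BorelJacquet1979, §4.2] -/
theorem isSmoothVector_of_mem_smoothFun {Φ : (adelicGroupData F E c N J).Adelic → (Fin 2 → ℂ)}
    (h : Φ ∈ smoothFun F E c N J) : (rightRep F E c N J).IsSmoothVector Φ :=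
  isSmoothVector_rightRep_iff_mem_smoothFun.mpr h

/-- **E2-pin-bridge input: an irreducible representation of `U(J)(𝔸_{F,f})` occurring in the cotangent forms is
smooth.** If `σ` is irreducible and `θ : W → (U(J)(𝔸_F) → ℂ²)` is a NON-ZERO `rightRep`-equivariant linear map with
values in some `A ≤ smoothFun` (e.g. `A = cohForms ιinf Kc`, `cohForms_le_smoothFun`, or the cotangent part of a
discrete automorphic representation), then `σ` is smooth — the `σ.IsSmooth` premise of
`Rogawski1990.cohFinComponent_isTheta` / `cohFinComponentUnique_hol` (Borel–Jacquet (1979), §4.2; Schur).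
[cite: BorelJacquet1979, §4.2] -/
theorem isSmooth_of_equivariant_of_le_smoothFun {W : Type*} [AddCommGroup W] [Module ℂ W]
    (σ : Representation ℂ (finAdelic F E c N J) W) (hirr : σ.IsIrreducible)
    (A : Submodule ℂ ((adelicGroupData F E c N J).Adelic → (Fin 2 → ℂ))) (hA : A ≤ smoothFun F E c N J)
    (θ : W →ₗ[ℂ] ((adelicGroupData F E c N J).Adelic → (Fin 2 → ℂ))) (hθ0 : θ ≠ 0) (hθA : ∀ w, θ w ∈ A)
    (heq : ∀ (g : finAdelic F E c N J) (w : W), θ (σ g w) = rightRep F E c N J g (θ w)) : σ.IsSmooth :=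
  σ.isSmooth_of_isIrreducible_of_forall_isSmoothVector (rightRep F E c N J) hirr θ heq hθ0
    fun w => isSmoothVector_of_mem_smoothFun (hA (hθA w))

end Smooth

end Literature.NumberTheory.Automorphic.UnitaryGroup.CotangentForms

end
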